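import Literature.Probability.LatticeModels.MarkovWindowPeeling
import Literature.MathematicalPhysics.KineticTheory.InfiniteChainTransferPeeling
import HarnessLib

/-!
# Interval Boltzmann integrals of nearest-neighbour chains in transfer-operator form

Topic `Literature/Probability/LatticeModels`; theorems only (no definitions, no named facts).
Companion of `MarkovWindowPeeling.lean` (same data and conventions: a measurable kernel
`k : S → S → ℝ≥0∞`, a one-site weight `w : S → ℝ≥0∞`, a σ-finite a priori measure `ν`; the
window weights `B a n σ = ∏_{j<n} k(σ_{a+j}, σ_{a+j+1}) ∏_{j≤n} w(σ_{a+j})` and the transfer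
operator `(T f)(z) = ∫ k(z, y) f(y) w(y) dν(y)` are VARIABLES constrained by `hB`, `hT`).

For the interval `Λ = {a-i, …, a+m+1+i}` the un-normalised nearest-neighbour Boltzmann weight
INCLUDING the two bonds to the boundary spins `u = η_{a-i-1}`, `v = η_{a+m+i+2}` is
`∏_{x∈Λ} w(σ_x) ∏_{y = a-i-1}^{a+m+1+i} k(σ_y, σ_{y+1})`. This file PROVES that its marginal
integral over `Λ` against an observable `Φ` read on the window `W = {a, …, a+m}` is

* `lmarginal_interval_eq_window` — the window integral
  `∫⋯∫⁻_W Φ · B a m · (T^i k_u)(σ_a) · (T^{i+1} k_v)(σ_{a+m})` (symmetric two-sided peeling,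
  `lmarginal_Icc_peel_iterate`, plus one extra site on the right);
* `lmarginal_interval_eq_lintegral_lintegral` — for `Φ` read on the INTERIOR `{a+1, …, a+m-1}`
  (`m = n + 2`), the double integral
  `∫∫ (T^i k_u)(x) w(x) M(x, y) (T^{i+1} k_v)(y) w(y) dν dν` against the "insertion kernel"
  `M(x,y) = ∫⋯∫⁻_{interior} Φ · B (a+1) n · k(x, σ_{a+1}) · k(σ_{a+n+1}, y)`;
* `lintegral_iterate_transfer_mul` — the Markov identity
  `∫ (T^i k_u)(x) H(x) w(x) dν(x) = (T^{i+1} H)(u)` (symmetric `k`), so that the interval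
  integral is `(T^{i+1} H)(u)` with `H(x) = ∫ M(x,y) (T^{i+1} k_v)(y) w(y) dν(y)`
  (`lmarginal_interval_eq_iterate_transfer`).

This is the "interval kernel = transfer-operator matrix element" step of the classical proof of
uniqueness of the Gibbs state of one-dimensional models with strictly positive transfer kernels
(Georgii 2011, Thm 10.25, §11.1; Cassandro–Olivieri–Pellegrinotti–Presutti 1978, §2 for unbounded
spins), in the form consumed by `Literature.Analysis.OperatorTheory.exists_kernelRatio_tendsto_uniformly`
(`N - 1 = i` sites between the left boundary spin and the window, `N` on the right).
[cite: Georgii2011, Thm 10.25 and §11.1]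
-/

noncomputable section

open MeasureTheory Set Function Finset
open Literature.MathematicalPhysics.KineticTheory.HeatConduction (prod_Icc_eq_prod_range')
open scoped ENNReal

namespace Literature.Probability.LatticeModels

variable {S : Type*} [MeasurableSpace S] {ν : Measure S}

/-! ### Bookkeeping on interval products

(The reindexing `∏_{i ∈ Icc l (l+n)} f i = ∏_{j < n+1} f (l + j)` is the tree's
`prod_Icc_eq_prod_range'` of `InfiniteChainTransferPeeling.lean`.) -/

variable {k : S → S → ℝ≥0∞} {w : S → ℝ≥0∞} {B : ℤ → ℕ → (ℤ → S) → ℝ≥0∞}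
  {T : (S → ℝ≥0∞) → (S → ℝ≥0∞)}

omit [MeasurableSpace S] in
/-- **Growing the window by one site on the right**:
`B a (n+1) σ = B a n σ · (k(σ_{a+n}, σ_{a+n+1}) w(σ_{a+n+1}))`. [folklore] -/
theorem B_succ
    (hB : ∀ a n σ, B a n σ = (∏ j ∈ Finset.range n, k (σ (a + j)) (σ (a + j + 1))) *
      ∏ j ∈ Finset.range (n + 1), w (σ (a + j)))
    (a : ℤ) (n : ℕ) (σ : ℤ → S) :
    B a (n + 1) σ = B a n σ * (k (σ (a + n)) (σ (a + n + 1)) * w (σ (a + n + 1))) := by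
  rw [hB, hB, Finset.prod_range_succ, Finset.prod_range_succ _ (n + 1)]
  push_cast
  ring

omit [MeasurableSpace S] in
/-- **The interval Boltzmann weight with its two boundary bonds is a padded window weight**: for
`Λ = {l, …, l+n}`,
`∏_{x∈Λ} w(σ_x) · ∏_{y=l-1}^{l+n} k(σ_y, σ_{y+1}) = k(σ_{l-1}, σ_l) · B l n σ · k(σ_{l+n}, σ_{l+n+1})`.
[folklore] -/
theorem intervalWeight_eq_boundary_mul_B
    (hB : ∀ a n σ, B a n σ = (∏ j ∈ Finset.range n, k (σ (a + j)) (σ (a + j + 1))) *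
      ∏ j ∈ Finset.range (n + 1), w (σ (a + j)))
    (l : ℤ) (n : ℕ) (σ : ℤ → S) :
    (∏ x ∈ Finset.Icc l (l + n), w (σ x)) * ∏ y ∈ Finset.Icc (l - 1) (l + n), k (σ y) (σ (y + 1)) =
      k (σ (l - 1)) (σ l) * B l n σ * k (σ (l + n)) (σ (l + n + 1)) := by
  have hset : Finset.Icc (l - 1) (l + n) = insert (l - 1) (Finset.Icc l (l + n)) := by
    ext x
    simp only [Finset.mem_Icc, Finset.mem_insert]
    omega
  have hnot : l - 1 ∉ Finset.Icc l (l + n) := by simp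
  rw [hset, Finset.prod_insert hnot, prod_Icc_eq_prod_range', prod_Icc_eq_prod_range',
    Finset.prod_range_succ (fun j => k (σ (l + j)) (σ (l + j + 1))), hB, sub_add_cancel]
  ring

/-! ### The interval integral as a window integral -/

/-- **Peeling an interval down to its window.** Let `Φ` be a measurable observable read on the
window `W = {a, …, a+m}`, `k` symmetric. For the interval `Λ = {a-i, …, a+m+1+i}` and every
boundary condition `η`, the marginal integral over `Λ` of `Φ` times the nearest-neighbour
Boltzmann weight of `Λ` INCLUDING the bonds to the boundary spins `u = η_{a-i-1}`,
`v = η_{a+m+i+2}` equals the window integral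
`∫⋯∫⁻_W Φ · B a m · (T^i k(u,·))(σ_a) · (T^{i+1} k(v,·))(σ_{a+m})`
(`i` sites integrated out on the left of the window, `i + 1` on the right).
[cite: Georgii2011, Thm 10.25 and §11.1] -/
theorem lmarginal_interval_eq_window [SigmaFinite ν] (hk : Measurable (uncurry k))
    (hw : Measurable w) (hsym : ∀ z y, k z y = k y z)
    (hB : ∀ a n σ, B a n σ = (∏ j ∈ Finset.range n, k (σ (a + j)) (σ (a + j + 1))) *
      ∏ j ∈ Finset.range (n + 1), w (σ (a + j)))
    (hT : ∀ f z, T f z = ∫⁻ y, k z y * f y * w y ∂ν)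
    {a : ℤ} {m : ℕ} {Φ : (ℤ → S) → ℝ≥0∞} (hΦm : Measurable Φ)
    (hΦd : DependsOn Φ (↑(Finset.Icc a (a + m)) : Set ℤ)) (i : ℕ) (η : ℤ → S) :
    (∫⋯∫⁻_Finset.Icc (a - i) (a + m + 1 + i),
        (fun σ => Φ σ * ((∏ x ∈ Finset.Icc (a - i) (a + m + 1 + i), w (σ x)) *
          ∏ y ∈ Finset.Icc (a - i - 1) (a + m + 1 + i), k (σ y) (σ (y + 1))))
        ∂fun _ : ℤ => ν) η =
      (∫⋯∫⁻_Finset.Icc a (a + m),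
        (fun σ => Φ σ * B a m σ * (T^[i] (k (η (a - i - 1)))) (σ a) *
          (T^[i + 1] (k (η (a + m + i + 2)))) (σ (a + m)))
        ∂fun _ : ℤ => ν) η := by
  classical
  set u : S := η (a - i - 1) with hu
  set v : S := η (a + m + i + 2) with hv
  -- Step 1: on the fibre over `η` the two boundary bonds read the boundary spins `u`, `v`
  have hstep1 : (∫⋯∫⁻_Finset.Icc (a - i) (a + m + 1 + i),
        (fun σ => Φ σ * ((∏ x ∈ Finset.Icc (a - i) (a + m + 1 + i), w (σ x)) *
          ∏ y ∈ Finset.Icc (a - i - 1) (a + m + 1 + i), k (σ y) (σ (y + 1))))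
        ∂fun _ : ℤ => ν) η =
      (∫⋯∫⁻_Finset.Icc (a - i) (a + m + 1 + i),
        (fun σ => Φ σ * B (a - i) (m + 1 + 2 * i) σ * k u (σ (a - i)) *
          k v (σ (a + m + 1 + i))) ∂fun _ : ℤ => ν) η := by
    refine lmarginal_congr_of_forall_updateFinset _ η fun ζ => ?_
    set σ : ℤ → S := updateFinset η (Finset.Icc (a - i) (a + m + 1 + i)) ζ with hσ
    have hl : a + m + 1 + i = (a - i) + ((m + 1 + 2 * i : ℕ) : ℤ) := by push_cast; ring
    have hprod := intervalWeight_eq_boundary_mul_B hB (a - i) (m + 1 + 2 * i) σ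
    rw [← hl, show a - (i : ℤ) - 1 = a - i - 1 from rfl] at hprod
    have hσl : σ (a - i - 1) = u := by
      have : a - (i : ℤ) - 1 ∉ Finset.Icc (a - i) (a + m + 1 + i) := by simp
      simp [hσ, updateFinset, this, hu]
    have hσr : σ (a + m + 1 + i + 1) = v := by
      have hnm : a + (m : ℤ) + 1 + i + 1 ∉ Finset.Icc (a - i) (a + m + 1 + i) := by
        simp only [Finset.mem_Icc]; omega
      have h2 : a + (m : ℤ) + 1 + i + 1 = a + m + i + 2 := by ring
      simp only [hσ, updateFinset, dif_neg hnm]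
      rw [h2]
    rw [hprod, hσl, hσr, hsym (σ (a + m + 1 + i)) v]
    ring
  rw [hstep1]
  -- Step 2: symmetric two-sided peeling down to the window `{a, …, a+m+1}`
  have hΦd' : DependsOn Φ (↑(Finset.Icc a (a + ((m + 1 : ℕ) : ℤ))) : Set ℤ) := by
    refine hΦd.mono ?_
    simp only [Finset.coe_Icc]
    exact Set.Icc_subset_Icc le_rfl (by push_cast; omega)
  have hpeel := lmarginal_Icc_peel_iterate (ν := ν) hk hw hsym hB hT hΦm hΦd'
    (hk.of_uncurry_left (x := u)) (hk.of_uncurry_left (x := v)) i η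
  have h1 : a + ((m + 1 : ℕ) : ℤ) + i = a + m + 1 + i := by push_cast; ring
  have h2 : m + 1 + 2 * i = (m + 1) + 2 * i := by ring
  rw [h1] at hpeel
  rw [h2, hpeel]
  -- Step 3: integrate out the extra site `a+m+1` on the right
  have hset : Finset.Icc a (a + ((m + 1 : ℕ) : ℤ)) = insert (a + m + 1) (Finset.Icc a (a + m)) := by
    ext x
    simp only [Finset.mem_Icc, Finset.mem_insert]
    push_cast
    omega
  have hnot : a + (m : ℤ) + 1 ∉ Finset.Icc a (a + m) := by simp
  have hmeas3 : Measurable fun σ : ℤ → S => Φ σ * B a (m + 1) σ * (T^[i] (k u)) (σ a) *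
      (T^[i] (k v)) (σ (a + ((m + 1 : ℕ) : ℤ))) :=
    ((hΦm.mul (measurable_B hk hw hB _ _)).mul
      ((measurable_iterate_T hk hw hT hk.of_uncurry_left i).comp (measurable_pi_apply _))).mul
      ((measurable_iterate_T hk hw hT hk.of_uncurry_left i).comp (measurable_pi_apply _))
  rw [hset, lmarginal_insert' _ hmeas3 hnot]
  refine lmarginal_congr_of_forall_updateFinset _ η fun ζ => ?_
  set x : ℤ → S := updateFinset η (Finset.Icc a (a + m)) ζ with hx
  -- the inner integral over the spin `z` at `a+m+1`
  have hcast : a + ((m + 1 : ℕ) : ℤ) = a + m + 1 := by push_cast; ring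
  have hinner : ∀ z : S, Φ (update x (a + m + 1) z) * B a (m + 1) (update x (a + m + 1) z) *
      (T^[i] (k u)) ((update x (a + m + 1) z) a) *
      (T^[i] (k v)) ((update x (a + m + 1) z) (a + ((m + 1 : ℕ) : ℤ))) =
      Φ x * B a m x * (T^[i] (k u)) (x a) *
        (k (x (a + m)) z * (T^[i] (k v)) z * w z) := by
    intro z
    have hΦz : Φ (update x (a + m + 1) z) = Φ x :=
      hΦd fun y hy => update_of_ne (by
        simp only [Finset.coe_Icc, Set.mem_Icc] at hy; omega) _ _
    have hBz : B a m (update x (a + m + 1) z) = B a m x :=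
      dependsOn_B hB a m fun y hy => update_of_ne (by
        simp only [Finset.coe_Icc, Set.mem_Icc] at hy; omega) _ _
    have ha : (update x (a + m + 1) z) a = x a := update_of_ne (by omega) _ _
    have ham : (update x (a + m + 1) z) (a + m) = x (a + m) := update_of_ne (by omega) _ _
    have hlast : (update x (a + m + 1) z) (a + m + 1) = z := update_self _ _ _
    rw [hcast, B_succ hB a m, hΦz, hBz, ha, ham, hlast]
    ring
  simp_rw [hinner]
  have hmz : Measurable fun z => k (x (a + m)) z * (T^[i] (k v)) z * w z :=
    (hk.of_uncurry_left.mul (measurable_iterate_T hk hw hT hk.of_uncurry_left i)).mul hw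
  rw [lintegral_const_mul _ hmz, ← hT, ← Function.iterate_succ_apply' T i]

/-! ### The window integral as a double integral against the insertion kernel -/

/-- **The interval integral as a double integral.** If the observable `Φ` is read on the INTERIOR
`{a+1, …, a+n+1}` of the window `W = {a, …, a+n+2}`, then for the interval
`Λ = {a-i, …, a+n+3+i}` and every `η` (boundary spins `u = η_{a-i-1}`, `v = η_{a+n+i+4}`)
`∫⋯∫⁻_Λ Φ · (Boltzmann weight of Λ with boundary bonds)
  = ∫∫ (T^i k(u,·))(x) w(x) · M(x, y) · (T^{i+1} k(v,·))(y) w(y) dν(x) dν(y)`,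
with the insertion kernel `M(x, y) = ∫⋯∫⁻_{interior} Φ · B (a+1) n · k(x, σ_{a+1}) · k(σ_{a+n+1}, y)`
(the spins at the two end sites of the window made explicit).
[cite: Georgii2011, Thm 10.25 and §11.1] -/
theorem lmarginal_interval_eq_lintegral_lintegral [SigmaFinite ν] (hk : Measurable (uncurry k))
    (hw : Measurable w) (hsym : ∀ z y, k z y = k y z)
    (hB : ∀ a n σ, B a n σ = (∏ j ∈ Finset.range n, k (σ (a + j)) (σ (a + j + 1))) *
      ∏ j ∈ Finset.range (n + 1), w (σ (a + j)))
    (hT : ∀ f z, T f z = ∫⁻ y, k z y * f y * w y ∂ν)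
    {a : ℤ} {n : ℕ} {Φ : (ℤ → S) → ℝ≥0∞} (hΦm : Measurable Φ)
    (hΦd : DependsOn Φ (↑(Finset.Icc (a + 1) (a + 1 + n)) : Set ℤ)) (i : ℕ) (η : ℤ → S) :
    (∫⋯∫⁻_Finset.Icc (a - i) (a + ((n + 2 : ℕ) : ℤ) + 1 + i),
        (fun σ => Φ σ * ((∏ x ∈ Finset.Icc (a - i) (a + ((n + 2 : ℕ) : ℤ) + 1 + i), w (σ x)) *
          ∏ y ∈ Finset.Icc (a - i - 1) (a + ((n + 2 : ℕ) : ℤ) + 1 + i), k (σ y) (σ (y + 1))))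
        ∂fun _ : ℤ => ν) η =
      ∫⁻ x, ∫⁻ y, (T^[i] (k (η (a - i - 1)))) x * w x *
        (∫⋯∫⁻_Finset.Icc (a + 1) (a + 1 + n),
          (fun σ => Φ σ * B (a + 1) n σ * k x (σ (a + 1)) * k (σ (a + 1 + n)) y)
          ∂fun _ : ℤ => ν) η *
        ((T^[i + 1] (k (η (a + ((n + 2 : ℕ) : ℤ) + i + 2)))) y * w y) ∂ν ∂ν := by
  have hΦdW : DependsOn Φ (↑(Finset.Icc a (a + ((n + 2 : ℕ) : ℤ))) : Set ℤ) := by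
    refine hΦd.mono ?_
    simp only [Finset.coe_Icc]
    exact Set.Icc_subset_Icc (by omega) (by push_cast; omega)
  rw [lmarginal_interval_eq_window hk hw hsym hB hT hΦm hΦdW i η]
  -- pad the interior by the two end sites of the window
  have hpad := lmarginal_Icc_pad_one (ν := ν) hk hw hB hΦm hΦd
    (measurable_iterate_T hk hw hT (hk.of_uncurry_left (x := η (a - i - 1))) i)
    (measurable_iterate_T hk hw hT (hk.of_uncurry_left (x := η (a + ((n + 2 : ℕ) : ℤ) + i + 2)))
      (i + 1)) η
  have h1 : a + 1 - 1 = a := by ring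
  have h2 : a + 1 + (n : ℤ) + 1 = a + ((n + 2 : ℕ) : ℤ) := by push_cast; ring
  rw [h1, h2] at hpad
  exact hpad

/-! ### The Markov identity for iterates of the transfer operator -/

/-- **`∫ (T^i k(u,·))(x) H(x) w(x) dν(x) = (T^{i+1} H)(u)`** for a symmetric kernel and measurable
`H`: integrating the `i`-th transfer iterate of a kernel section against `H w` is one more
application of `T` (Tonelli and the symmetry `k(x,y) = k(y,x)`; the block analogue of
"`K^{(i+1)}(u, ·) = T^i k(u, ·)`"). [folklore] -/
theorem lintegral_iterate_transfer_mul [SigmaFinite ν] (hk : Measurable (uncurry k))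
    (hw : Measurable w) (hsym : ∀ z y, k z y = k y z)
    (hT : ∀ f z, T f z = ∫⁻ y, k z y * f y * w y ∂ν) (u : S) (i : ℕ) :
    ∀ {H : S → ℝ≥0∞}, Measurable H →
      ∫⁻ x, (T^[i] (k u)) x * H x * w x ∂ν = (T^[i + 1] H) u := by
  induction i with
  | zero =>
    intro H _
    rw [Function.iterate_zero, id_eq, Function.iterate_one, hT]
  | succ i ih =>
    intro H hH
    have hTi : Measurable (T^[i] (k u)) := measurable_iterate_T hk hw hT hk.of_uncurry_left i
    -- expand the outer iterate once and swap the two integrations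
    have hexp : ∀ x, (T^[i + 1] (k u)) x = ∫⁻ y, k x y * (T^[i] (k u)) y * w y ∂ν := fun x => by
      rw [Function.iterate_succ_apply', hT]
    simp_rw [hexp]
    have hmeas : Measurable (uncurry fun x y => k x y * (T^[i] (k u)) y * w y * H x * w x) :=
      (((hk.mul (hTi.comp measurable_snd)).mul (hw.comp measurable_snd)).mul
        (hH.comp measurable_fst)).mul (hw.comp measurable_fst)
    calc ∫⁻ x, (∫⁻ y, k x y * (T^[i] (k u)) y * w y ∂ν) * H x * w x ∂ν
        = ∫⁻ x, ∫⁻ y, k x y * (T^[i] (k u)) y * w y * H x * w x ∂ν ∂ν := by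
          refine lintegral_congr fun x => ?_
          have hm1 : Measurable fun y => k x y * (T^[i] (k u)) y * w y :=
            (hk.of_uncurry_left.mul hTi).mul hw
          have hm2 : Measurable fun y => k x y * (T^[i] (k u)) y * w y * H x := hm1.mul_const _
          rw [lintegral_mul_const (w x) hm2, lintegral_mul_const (H x) hm1]
      _ = ∫⁻ y, ∫⁻ x, k x y * (T^[i] (k u)) y * w y * H x * w x ∂ν ∂ν :=
          lintegral_lintegral_swap hmeas.aemeasurable
      _ = ∫⁻ y, (T^[i] (k u)) y * (T H) y * w y ∂ν := by
          refine lintegral_congr fun y => ?_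
          rw [hT H y]
          have : ∀ x, k x y * (T^[i] (k u)) y * w y * H x * w x =
              (T^[i] (k u)) y * w y * (k y x * H x * w x) := fun x => by rw [hsym x y]; ring
          simp_rw [this]
          have hm3 : Measurable fun x => k y x * H x * w x := (hk.of_uncurry_left.mul hH).mul hw
          rw [lintegral_const_mul _ hm3]
          ring
      _ = (T^[i + 1] (T H)) u := ih (measurable_T hk hw hT hH)
      _ = (T^[i + 1 + 1] H) u := by rw [← Function.iterate_succ_apply T (i + 1) H]

/-- **The interval integral as an iterate of the transfer operator at the left boundary spin.**
Under the hypotheses of `lmarginal_interval_eq_lintegral_lintegral`, the interval integral is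
`(T^{i+1} H)(u)` with `H(x) = ∫ M(x, y) (T^{i+1} k(v,·))(y) w(y) dν(y)` — `i + 1` transfer steps
from the left boundary spin `u` to the left end of the window and `i + 1` from the right end to
`v`: the form `κ^N [x ↦ ∫ m(x,y) (κ^N K(v,·))(y)] (u)` (`N = i + 1`) of
`Literature.Analysis.OperatorTheory.exists_kernelRatio_tendsto_uniformly`.
[cite: Georgii2011, Thm 10.25 and §11.1] -/
theorem lmarginal_interval_eq_iterate_transfer [SigmaFinite ν] (hk : Measurable (uncurry k))
    (hw : Measurable w) (hsym : ∀ z y, k z y = k y z)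
    (hB : ∀ a n σ, B a n σ = (∏ j ∈ Finset.range n, k (σ (a + j)) (σ (a + j + 1))) *
      ∏ j ∈ Finset.range (n + 1), w (σ (a + j)))
    (hT : ∀ f z, T f z = ∫⁻ y, k z y * f y * w y ∂ν)
    {a : ℤ} {n : ℕ} {Φ : (ℤ → S) → ℝ≥0∞} (hΦm : Measurable Φ)
    (hΦd : DependsOn Φ (↑(Finset.Icc (a + 1) (a + 1 + n)) : Set ℤ)) (i : ℕ) (η : ℤ → S)
    {M : S → S → ℝ≥0∞}
    (hM : ∀ x y, M x y = (∫⋯∫⁻_Finset.Icc (a + 1) (a + 1 + n),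
      (fun σ => Φ σ * B (a + 1) n σ * k x (σ (a + 1)) * k (σ (a + 1 + n)) y) ∂fun _ : ℤ => ν) η)
    (hMm : Measurable (uncurry M)) :
    (∫⋯∫⁻_Finset.Icc (a - i) (a + ((n + 2 : ℕ) : ℤ) + 1 + i),
        (fun σ => Φ σ * ((∏ x ∈ Finset.Icc (a - i) (a + ((n + 2 : ℕ) : ℤ) + 1 + i), w (σ x)) *
          ∏ y ∈ Finset.Icc (a - i - 1) (a + ((n + 2 : ℕ) : ℤ) + 1 + i), k (σ y) (σ (y + 1))))
        ∂fun _ : ℤ => ν) η =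
      (T^[i + 1] fun x => ∫⁻ y, M x y *
        ((T^[i + 1] (k (η (a + ((n + 2 : ℕ) : ℤ) + i + 2)))) y * w y) ∂ν) (η (a - i - 1)) := by
  rw [lmarginal_interval_eq_lintegral_lintegral hk hw hsym hB hT hΦm hΦd i η]
  set v : S := η (a + ((n + 2 : ℕ) : ℤ) + i + 2) with hv
  have hG : Measurable fun y => (T^[i + 1] (k v)) y * w y :=
    (measurable_iterate_T hk hw hT hk.of_uncurry_left (i + 1)).mul hw
  have hH : Measurable fun x => ∫⁻ y, M x y * ((T^[i + 1] (k v)) y * w y) ∂ν :=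
    (hMm.mul (hG.comp measurable_snd)).lintegral_prod_right'
  rw [← lintegral_iterate_transfer_mul hk hw hsym hT (η (a - i - 1)) i hH]
  refine lintegral_congr fun x => ?_
  simp_rw [← hM]
  have hMx : Measurable (M x) := hMm.of_uncurry_left
  have hre : ∀ y, (T^[i] (k (η (a - i - 1)))) x * w x * M x y * ((T^[i + 1] (k v)) y * w y) =
      (T^[i] (k (η (a - i - 1)))) x * w x * (M x y * ((T^[i + 1] (k v)) y * w y)) := fun y => by
    ring
  simp_rw [hre]
  have hm4 : Measurable fun y => M x y * ((T^[i + 1] (k v)) y * w y) := hMx.mul hG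
  rw [lintegral_const_mul _ hm4]
  ring

end Literature.Probability.LatticeModels

end
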